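import Summits.ValiantsHypothesis.ValiantsHypothesis.Theorems.GrenetZeonTwoDimCoefficientsGradedUnit
import HarnessLib

/-!
# DefinabilityGap — UNIT RIGIDITY, stage S1a: the `c`-local span and top forms

Route `route-ValiantsHypothesis-DefinabilityGap` (DRAFT), read-once leaf F4 / W10 (aside
`KIPlantedHittingRO`, stmt-ValiantsHypothesis-23704), leaf `ZperHits₂(m)` = hypothesis `hZ` of
`DefinabilityGapZperTransfer.chainVal_eq_zero_of_bind₁_kiPer`. UNIT RIGIDITY (decomp-valiant bus, OFFER
O-L5-UR / CALL l.1120): for `c < m`, no width-2 chain of UNIT univariate-image links with `c`-local arguments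
computes a non-zero multiple of `per_m` — the unit-links sub-case of the leaf, size-free (every `m > c`, every
length, every field). This file is the commutative-algebra half (S1a of the pre-declared split S1a / S1b / S2):

* `locSpan K σ c` — the `K`-span of the monomials in at most `c` distinct variables (a `Submodule`; it contains
  the constants, is stable under homogeneous components, and contains `aeval x p` whenever `|vars x| ≤ c`);
  KEY `eq_zero_of_mem_locSpan_of_perPoly_dvd`: `locSpan ∩ (per_m) = 0` for `c < m` (every monomial of `per_m · H`
  meets all `m` rows);
* `topForm f` — the top homogeneous component; `topForm (f g) = topForm f · topForm g` (domain),
  `topForm (f - g) = topForm f` for `deg g < deg f`, `per_m ∣ f ⇒ per_m ∣ topForm f` (`per_m` homogeneous)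
  — reusing the landed `GrenetZeonTwoDimCoefficients.homogeneousComponent_mul_totalDegree` /
  `dvd_homogeneousComponent_of_dvd` (route-independent module `GrenetZeonTwoDimCoefficientsGradedUnit`);
* `walk_step` — one step `(x, y) ↦ (a x - y, x)` of the row walk preserves
  `x ≠ 0 ∧ per_m ∤ topForm x ∧ deg y ≤ deg x` when `a ≠ 0` is non-constant with `per_m ∤ topForm a`
  (`per_m` PRIME, `perPoly_irreducible`);
* the letter matrices `eM a = E(a) = [[a,1],[-1,0]]`, `dmat κ μ = diag(κ, μ)` and Cohn's three `GE₂` relations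
  `E(y)E(0)E(a) = -E(y+a)`, `E(x)E(g)E(a) = diag(g',g)·E(g²x-g)·E(a-g')` (`g g' = 1`),
  `E(z)·diag(κ,μ) = diag(μ,κ)·E(μ'κ z)` (`μ μ' = 1`), over any commutative ring.

HONEST GRADE (critic, l.1120): Allender–Wang's indg mechanism (Bringmann–Ikenmeyer–Zuiddam JACM 2018 Thm 5.6)
transplanted from «hd(p) = product of affine forms» to «top form prime to `per_m` inside the `c`-local span» +
Cohn 1966 `GE₂` rewriting keeping entries `c`-local; kernel sub-case of the leaf `hZ`; closes no item;
0 S-currency; rung 0; VP ≠ VNP untouched. No facts, no Prop-valued definitions, no placeholders.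
-/

-- single-conjunct layout `Summits/ValiantsHypothesis/ValiantsHypothesis`: the duplicated namespace
-- component is mandated by the tree.
set_option linter.dupNamespace false

open MvPolynomial Finset
open scoped Pointwise
open Literature.Computability.AlgebraicComplexity

namespace Summit.ValiantsHypothesis.ValiantsHypothesis.Theorems.DefinabilityGapUnitRigidityForms

noncomputable section

variable {K : Type*} [Field K] {σ : Type*}

/-! ## 1. The `c`-local span -/

/-- The `c`-LOCAL SPAN: the `K`-span of the monomials using at most `c` distinct variables. [this file] -/
def locSpan (K σ : Type*) [Field K] (c : ℕ) : Submodule K (MvPolynomial σ K) where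
  carrier := {f | ∀ d ∈ f.support, d.support.card ≤ c}
  add_mem' := by
    classical
    intro f g hf hg
    simp only [Set.mem_setOf_eq] at hf hg ⊢
    intro d hd
    rcases Finset.mem_union.1 (support_add hd) with h | h
    exacts [hf d h, hg d h]
  zero_mem' := by
    simp only [Set.mem_setOf_eq]
    intro d hd
    simp at hd
  smul_mem' := by
    intro a f hf
    simp only [Set.mem_setOf_eq] at hf ⊢
    exact fun d hd => hf d (support_smul hd)

/-- Membership in the `c`-local span. [this file] -/
theorem mem_locSpan {c : ℕ} {f : MvPolynomial σ K} :
    f ∈ locSpan K σ c ↔ ∀ d ∈ f.support, d.support.card ≤ c :=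
  Iff.rfl

/-- A polynomial in at most `c` variables lies in the `c`-local span. [this file] -/
theorem mem_locSpan_of_vars {c : ℕ} {f : MvPolynomial σ K} (h : f.vars.card ≤ c) :
    f ∈ locSpan K σ c := by
  rw [mem_locSpan]
  intro d hd
  refine le_trans (Finset.card_le_card fun i hi => ?_) h
  exact (mem_vars_iff_mem_support i).2 ⟨d, hd, hi⟩

/-- Constants are `c`-local. [this file] -/
theorem C_mem_locSpan (c : ℕ) (a : K) : (C a : MvPolynomial σ K) ∈ locSpan K σ c :=
  mem_locSpan_of_vars (by simp [vars_C])

/-- Scaling by a constant. [this file] -/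
theorem C_mul_mem_locSpan {c : ℕ} {f : MvPolynomial σ K} (hf : f ∈ locSpan K σ c) (a : K) :
    C a * f ∈ locSpan K σ c := by
  rw [C_mul']
  exact Submodule.smul_mem _ a hf

/-- Homogeneous components of `c`-local polynomials are `c`-local. [this file] -/
theorem homogeneousComponent_mem_locSpan {c : ℕ} {f : MvPolynomial σ K} (hf : f ∈ locSpan K σ c)
    (n : ℕ) : homogeneousComponent n f ∈ locSpan K σ c := by
  rw [mem_locSpan] at hf ⊢
  intro d hd
  apply hf d
  rw [mem_support_iff] at hd ⊢
  rw [coeff_homogeneousComponent] at hd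
  intro h0
  apply hd
  simp [h0]

/-- Univariate images `p(x)` of a polynomial `x` in at most `c` variables are `c`-local. [this file] -/
theorem aeval_mem_locSpan {c : ℕ} {x : MvPolynomial σ K} (hx : x.vars.card ≤ c) (p : Polynomial K) :
    Polynomial.aeval x p ∈ locSpan K σ c := by
  rw [Polynomial.aeval_eq_sum_range]
  refine Submodule.sum_mem _ fun i _ => Submodule.smul_mem _ _ (mem_locSpan_of_vars ?_)
  exact le_trans (Finset.card_le_card (vars_pow x i)) hx

/-- KEY: for `c < m` the `c`-local span meets the ideal `(per_m)` only in `0` — every monomial of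
`per_m · H` is a permutation monomial times a monomial of `H`, so it meets all `m` rows. [this file] -/
theorem eq_zero_of_mem_locSpan_of_perPoly_dvd {m c : ℕ} (hcm : c < m)
    {f : MvPolynomial (Fin m × Fin m) K} (hf : f ∈ locSpan K (Fin m × Fin m) c)
    (h : perPoly (Fin m) K ∣ f) : f = 0 := by
  classical
  obtain ⟨H, rfl⟩ := h
  by_contra hne
  obtain ⟨d, hd⟩ := support_nonempty.2 hne
  have hc := (mem_locSpan.1 hf) d hd
  obtain ⟨a, ha, b, -, rfl⟩ := Finset.mem_add.1 (support_mul _ _ hd)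
  obtain ⟨ρ, rfl⟩ := exists_permMonomial_eq_of_coeff_perPoly_ne_zero K (mem_support_iff.1 ha)
  have hm : m ≤ (permMonomial ρ + b).support.card := by
    calc m = (univ.image fun i : Fin m => (ρ i, i)).card := by
          rw [card_image_of_injective _ fun i j hij => (Prod.mk.inj hij).2, card_univ,
            Fintype.card_fin]
      _ ≤ (permMonomial ρ + b).support.card := card_le_card fun v hv => by
          obtain ⟨i, -, rfl⟩ := mem_image.1 hv
          have h1 : permMonomial ρ (ρ i, i) = 1 := by rw [permMonomial_apply, if_pos rfl]
          show (ρ i, i) ∈ (permMonomial ρ + b).support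
          rw [Finsupp.mem_support_iff, Finsupp.add_apply, h1]
          omega
  omega

/-! ## 2. Top forms -/

/-- The top homogeneous component `f_{(deg f)}`. [this file] -/
def topForm (f : MvPolynomial σ K) : MvPolynomial σ K := homogeneousComponent f.totalDegree f

/-- The top form of a non-zero polynomial is non-zero. [this file] -/
theorem topForm_ne_zero {f : MvPolynomial σ K} (hf : f ≠ 0) : topForm f ≠ 0 := by
  classical
  obtain ⟨s, hs, hdeg⟩ := Finset.exists_mem_eq_sup _ (support_nonempty.mpr hf)
    (fun s : σ →₀ ℕ => s.sum fun _ e => e)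
  intro h
  have hc := congrArg (coeff s) h
  unfold topForm at hc
  rw [coeff_homogeneousComponent, if_pos (by rw [Finsupp.degree_apply]; exact hdeg.symm),
    coeff_zero] at hc
  exact (mem_support_iff.mp hs) hc

/-- The top form of a `c`-local polynomial is `c`-local. [this file] -/
theorem topForm_mem_locSpan {c : ℕ} {f : MvPolynomial σ K} (hf : f ∈ locSpan K σ c) :
    topForm f ∈ locSpan K σ c :=
  homogeneousComponent_mem_locSpan hf _

/-- `topForm` is multiplicative on non-zero polynomials (`K[σ]` is a domain; top components multiply,
`GrenetZeonTwoDimCoefficients.homogeneousComponent_mul_totalDegree`). [this file] -/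
theorem topForm_mul {f g : MvPolynomial σ K} (hf : f ≠ 0) (hg : g ≠ 0) :
    topForm (f * g) = topForm f * topForm g := by
  unfold topForm
  rw [totalDegree_mul_of_isDomain hf hg, GrenetZeonTwoDimCoefficients.homogeneousComponent_mul_totalDegree]

/-- Subtracting a polynomial of smaller degree does not change the degree … [this file] -/
theorem totalDegree_sub_of_lt {f g : MvPolynomial σ K} (h : g.totalDegree < f.totalDegree) :
    (f - g).totalDegree = f.totalDegree := by
  rw [sub_eq_add_neg, totalDegree_add_eq_left_of_totalDegree_lt (by rwa [totalDegree_neg])]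

/-- … nor the top form. [this file] -/
theorem topForm_sub_of_lt {f g : MvPolynomial σ K} (h : g.totalDegree < f.totalDegree) :
    topForm (f - g) = topForm f := by
  unfold topForm
  rw [totalDegree_sub_of_lt h, map_sub, homogeneousComponent_eq_zero _ _ h, sub_zero]

/-- Scaling by a non-zero constant does not change the degree. [this file] -/
theorem totalDegree_C_mul {f : MvPolynomial σ K} {a : K} (ha : a ≠ 0) :
    (C a * f).totalDegree = f.totalDegree := by
  by_cases hf : f = 0
  · simp [hf]
  · rw [totalDegree_mul_of_isDomain (mt C_eq_zero.1 ha) hf, totalDegree_C, zero_add]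

/-- Subtracting a constant from a non-constant polynomial does not change the degree. [this file] -/
theorem totalDegree_sub_C {f : MvPolynomial σ K} (hf : f.totalDegree ≠ 0) (a : K) :
    (f - C a).totalDegree = f.totalDegree :=
  totalDegree_sub_of_lt (by rw [totalDegree_C]; omega)

/-- `P ∤ topForm f ⇒ P ∤ f` for homogeneous `P` (a homogeneous divisor divides every component,
`GrenetZeonTwoDimCoefficients.dvd_homogeneousComponent_of_dvd`). [this file] -/
theorem not_dvd_of_not_dvd_topForm {P f : MvPolynomial σ K} {k : ℕ} (hP : P.IsHomogeneous k)
    (h : ¬ P ∣ topForm f) : ¬ P ∣ f :=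
  fun hd => h (GrenetZeonTwoDimCoefficients.dvd_homogeneousComponent_of_dvd hP hd _)

/-! ## 3. `per_m`: prime, homogeneous, and prime to every non-zero `c`-local top form (`c < m`) -/

/-- `per_m` is prime (`m ≥ 1`). [this file] -/
theorem perPoly_prime {m : ℕ} (hm : 0 < m) : Prime (perPoly (Fin m) K) := by
  haveI : Nonempty (Fin m) := ⟨⟨0, hm⟩⟩
  exact UniqueFactorizationMonoid.irreducible_iff_prime.mp perPoly_irreducible

/-- `per_m` divides no non-zero constant. [this file] -/
theorem not_perPoly_dvd_C {m : ℕ} (hm : 0 < m) {a : K} (ha : a ≠ 0) :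
    ¬ perPoly (Fin m) K ∣ C a :=
  fun h => (perPoly_prime hm).not_unit (isUnit_of_dvd_unit h ((IsUnit.mk0 a ha).map C))

/-- `per_m ∤ topForm f ⇒ per_m ∤ f`. [this file] -/
theorem not_perPoly_dvd_of_topForm {m : ℕ} {f : MvPolynomial (Fin m × Fin m) K}
    (h : ¬ perPoly (Fin m) K ∣ topForm f) : ¬ perPoly (Fin m) K ∣ f :=
  not_dvd_of_not_dvd_topForm (perPoly_isHomogeneous (n := Fin m) (k := K)) h

/-- KEY on top forms: the top form of a non-zero `c`-local polynomial is prime to `per_m` (`c < m`). [this file] -/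
theorem not_perPoly_dvd_topForm {m c : ℕ} (hcm : c < m) {f : MvPolynomial (Fin m × Fin m) K}
    (hf : f ∈ locSpan K (Fin m × Fin m) c) (h0 : f ≠ 0) : ¬ perPoly (Fin m) K ∣ topForm f :=
  fun hd => topForm_ne_zero h0 (eq_zero_of_mem_locSpan_of_perPoly_dvd hcm (topForm_mem_locSpan hf) hd)

/-- The top form of a constant. [this file] -/
theorem topForm_C (a : K) : topForm (C a : MvPolynomial σ K) = C a := by
  unfold topForm
  rw [totalDegree_C, homogeneousComponent_zero, coeff_zero_C]

/-- ONE STEP OF THE ROW WALK `(x, y) ↦ (x a - y, x)`: the invariant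
`x ≠ 0 ∧ per_m ∤ topForm x ∧ deg y ≤ deg x` survives a non-constant step `a` with `per_m ∤ topForm a`
(no cancellation of top forms; Euclid's lemma for the prime `per_m`). [this file] -/
theorem walk_step {m : ℕ} (hm : 0 < m) {x y a : MvPolynomial (Fin m × Fin m) K} (hx : x ≠ 0)
    (hxP : ¬ perPoly (Fin m) K ∣ topForm x) (hyx : y.totalDegree ≤ x.totalDegree) (ha0 : a ≠ 0)
    (ha1 : a.totalDegree ≠ 0) (haP : ¬ perPoly (Fin m) K ∣ topForm a) :
    x * a - y ≠ 0 ∧ ¬ perPoly (Fin m) K ∣ topForm (x * a - y) ∧ x.totalDegree ≤ (x * a - y).totalDegree := by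
  have hdeg : (x * a).totalDegree = x.totalDegree + a.totalDegree := totalDegree_mul_of_isDomain hx ha0
  have hlt : y.totalDegree < (x * a).totalDegree := by omega
  have hd2 : (x * a - y).totalDegree = (x * a).totalDegree := totalDegree_sub_of_lt hlt
  refine ⟨fun h0 => ?_, ?_, by omega⟩
  · rw [h0, totalDegree_zero] at hd2
    omega
  · rw [topForm_sub_of_lt hlt, topForm_mul hx ha0]
    exact fun hd => ((perPoly_prime hm).dvd_or_dvd hd).elim hxP haP

/-! ## 4. Letter matrices and Cohn's `GE₂` relations (any commutative ring)

All identities are stated RIGHT-associated (`P * (Q * Y)`), the normal form used by the word calculus of S1b. -/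

/-- The elementary letter `E(a) = [[a, 1], [-1, 0]]`. [this file] -/
def eM {A : Type*} [CommRing A] (a : A) : Matrix (Fin 2) (Fin 2) A := !![a, 1; -1, 0]

/-- The diagonal letter `diag(κ, μ)`. [this file] -/
def dmat {A : Type*} [CommRing A] (κ μ : A) : Matrix (Fin 2) (Fin 2) A := !![κ, 0; 0, μ]

/-- Equality of `2 × 2` literal matrices from equality of their entries. [this file] -/
theorem fin_two_eq {A : Type*} {a b c d a' b' c' d' : A} (h₁ : a = a') (h₂ : b = b') (h₃ : c = c')
    (h₄ : d = d') : !![a, b; c, d] = !![a', b'; c', d'] := by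
  rw [h₁, h₂, h₃, h₄]

variable {A : Type*} [CommRing A]

/-- Conjugation of a two-factor relation past a right factor. [this file] -/
theorem conj₂ {P Q R S : Matrix (Fin 2) (Fin 2) A} (h : P * Q = R * S) (Y : Matrix (Fin 2) (Fin 2) A) :
    P * (Q * Y) = R * (S * Y) := by
  rw [← Matrix.mul_assoc, h, Matrix.mul_assoc]

/-- Row `0` of `N · E(z)` is `(N₀₀ z - N₀₁, N₀₀)` — one step of the row walk. [this file] -/
theorem mul_eM_apply (N : Matrix (Fin 2) (Fin 2) A) (z : A) :
    (N * eM z) 0 0 = N 0 0 * z - N 0 1 ∧ (N * eM z) 0 1 = N 0 0 := by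
  constructor <;> simp [eM, Matrix.mul_apply, Fin.sum_univ_two]
  ring

/-- Entries of `E(b)` in row `0`. [this file] -/
theorem eM_apply (b : A) : eM b 0 0 = b ∧ eM b 0 1 = 1 := by
  constructor <;> simp [eM]

/-- Row `0` of `diag(κ, μ) · N` is `κ · (row 0 of N)`. [this file] -/
theorem dmat_mul_apply (κ μ : A) (N : Matrix (Fin 2) (Fin 2) A) (j : Fin 2) :
    (dmat κ μ * N) 0 j = κ * N 0 j := by
  simp [dmat, Matrix.mul_apply, Fin.sum_univ_two]

/-- `diag · diag`, right-associated. [this file] -/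
theorem dmat_mul_dmat_mul (κ μ κ' μ' : A) (Y : Matrix (Fin 2) (Fin 2) A) :
    dmat κ μ * (dmat κ' μ' * Y) = dmat (κ * κ') (μ * μ') * Y := by
  rw [← Matrix.mul_assoc]
  congr 1
  simp only [dmat, Matrix.mul_fin_two]
  exact fin_two_eq (by ring) (by ring) (by ring) (by ring)

/-- The sign `diag(-1, -1)` is central. [this file] -/
theorem mul_dmat_neg_one_mul (X Y : Matrix (Fin 2) (Fin 2) A) :
    X * (dmat (-1) (-1) * Y) = dmat (-1) (-1) * (X * Y) := by
  have h : (dmat (-1) (-1) : Matrix (Fin 2) (Fin 2) A) = -1 := by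
    rw [Matrix.one_fin_two]
    simp only [dmat]
    ext i j
    fin_cases i <;> fin_cases j <;> simp
  rw [h, neg_one_mul, neg_one_mul, Matrix.mul_neg]

/-- Cohn (M1): `E(y) E(0) E(a) = diag(-1, -1) · E(y + a)`. [this file] -/
theorem eM_mul_eM_zero_mul_eM (y a : A) : eM y * (eM 0 * eM a) = dmat (-1) (-1) * eM (y + a) := by
  simp only [eM, dmat, Matrix.mul_fin_two]
  exact fin_two_eq (by ring) (by ring) (by ring) (by ring)

/-- Cohn (M2): `E(x) E(g) E(a) = diag(g', g) · E(g² x - g) · E(a - g')` whenever `g g' = 1`. [this file] -/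
theorem eM_mul_eM_unit_mul_eM (x a g g' : A) (h : g * g' = 1) :
    eM x * (eM g * eM a) = dmat g' g * (eM (g ^ 2 * x - g) * eM (a - g')) := by
  simp only [eM, dmat, Matrix.mul_fin_two]
  exact fin_two_eq (by linear_combination (-(g * x * a) + a + x * (g * g' + 1) - g') * h)
    (by linear_combination (1 - x * g) * h) (by linear_combination (-1 : A) * h) (by ring)

/-- Cohn (M3): `E(z) · diag(κ, μ) = diag(μ, κ) · E(μ' κ z)` whenever `μ μ' = 1`. [this file] -/
theorem eM_mul_dmat (z κ μ μ' : A) (h : μ * μ' = 1) :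
    eM z * dmat κ μ = dmat μ κ * eM (μ' * κ * z) := by
  simp only [eM, dmat, Matrix.mul_fin_two]
  exact fin_two_eq (by linear_combination (-(κ * z)) * h) (by ring) (by ring) (by ring)

/-- A letter `T(a, κ, μ) = [[κ a, μ], [-κ, 0]]` factors as `E(a) · diag(κ, μ)`. [this file] -/
theorem letter_eq_eM_mul_dmat (a κ μ : A) : !![κ * a, μ; -κ, 0] = eM a * dmat κ μ := by
  simp only [eM, dmat, Matrix.mul_fin_two]
  exact fin_two_eq (by ring) (by ring) (by ring) (by ring)

end

end Summit.ValiantsHypothesis.ValiantsHypothesis.Theorems.DefinabilityGapUnitRigidityForms
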